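import Mathlib
import HarnessLib
import HarnessLib.Audit
import Summits.KontsevichZagierPeriods.Statement
import Summits.KontsevichZagierPeriods.KontsevichZagierPeriods.Theorems.GrothendieckGpcLegendreLemniscatic
import HarnessLib.Audit.Status.Attr

/-!
Route: ZeroPortrait

DORMANT since 2026-08-23T19:03:43Z (reconciler: no traction for 6.2 d (last activity item-evidence-added at 2026-08-17T14:22:03Z); parked, not closed — `ledger route dormant route-KontsevichZagierPeriods-ZeroPortrait --off` to reactivat) — unstaffed, not closed; items shared with open routes are served there. `ledger route dormant <id> --off` reactivates.

# Route ZeroPortrait — zero portraits of ℚ-pencils — Sturm budgets pin Conjecture 1 on the Legendre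
and beta pencils to two chains and one residue

It suffices to show X = PencilPortrait ∧ BetaPortrait ∧ GpcLegendreLemniscatic ∧
TriplicationAccessible ∧ QuadraticResidue, plus the
declared remainder PencilComplete: Conjecture 1 on two ℚ-PENCILS of pairs is a ZERO COUNT. Legendre
quadratic pencil Q =
{([(0,1)², a·k_s(x₀)k_s(x₁) + b·e_s(x₀)k_s(x₁) + c·e_s(x₀)e_s(x₁)], [ℝ, 1/(2(1+x²))]) : a,b,c,s ∈ ℚ,
0<s<1} (values aK²+bEK+cE² at k² = s
against π/2; k_s(t) = 1/√((1−t²)(1−st²)), e_s(t) = √(1−st²)/√(1−t²)); beta pencil B = {([(0,1)²,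
x^(s−1)(1−x)^(−5/9)·y^(−4/9)(1−y)^(−2/9)],
[disc of radius 2, 3^(7/6)/2]) : s ∈ ℚ, s>0} (values B(s,4/9)·B(5/9,7/9) against 2π·3^(7/6)).
PencilPortrait: the Legendre shape (−1,2,0) meets
π/2 only at s = 1/2 (Sturm budget 1: D′ = E(E−K)/(s(1−s)) < 0); BetaPortrait: the beta pencil meets
its constant only at s = 1/9 (monotone);
GpcLegendreLemniscatic (= Grothendieck 0280) and TriplicationAccessible (= Neg 0312): the two
explained coincidences are KZ-chains;
QuadraticResidue: no other rational coincidence on Q (the residue, GPC-strength, declared);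
PencilComplete: the calculus enlarged by the
pencils' coincidences connects all equal-valued rational pairs (NOT CLAIMED). Realises card
zero-portrait-sturm-saturation (spine): the zero
portrait budget/ledger/residue of a family, with QuadraticBudget (rank-4 count, accuracy one) as the
mechanism's first test beyond rank 2.
Lean: `PencilPortrait ∧ BetaPortrait ∧ GpcLegendreLemniscatic ∧ TriplicationAccessible ∧
QuadraticResidue ∧ PencilComplete`

## Assembly
Pure logic, certified in the planner's Sketch.lean / glue.lean (lean check rc 0, 0 sorries): for
rational ρ, ρ′ of equal value PencilComplete
puts [ρ] − [ρ′] in relations ⊔ ⟨Legendre-pencil coincidences⟩ ⊔ ⟨beta-pencil coincidences⟩, and each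
generator lies in relations: a
Legendre-pencil coincidence either has shape ≠ (−1,2,0), impossible by QuadraticResidue, or shape
(−1,2,0), where PencilPortrait gives s = 1/2
and the pair is literally an instance of GpcLegendreLemniscatic (1 − (1/2)x² = 1 − x²/2 by
push_cast; ring_nf); a beta-pencil coincidence has
s = 1/9 by BetaPortrait and is literally an instance of TriplicationAccessible (x^(1/9−1) = x^(−8/9)
by norm_num). QuadraticBudget is not a
hypothesis of `closes`: it bounds the residue, it does not discharge it.

Rationale: WHY THIS LINE. Mechanism (card zero-portrait-sturm-saturation): in a ℚ-pencil (r_s, r′_s) the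
Conjecture-1 instances are exactly the rational zeros of the
real-analytic D(s) = value r_s − value r′_s, and REAL OSCILLATION THEORY of the Picard–Fuchs system
— Sturm (a signed solution has no zero),
Pólya–Mammana disconjugacy, Petrov's argument principle (doi:10.2140/pjm.2002.202.341 Thm 1),
effective o-minimality (arXiv:2405.16963) —
bounds their NUMBER from integrand positivity, order information the equational calculus never
consumes. Imported area: zeros of abelian
integrals / infinitesimal Hilbert 16 (Petrov; Gasull–Li–Llibre–Zhang; Gavrilov–Iliev
arXiv:math/0211386; Christopher–Li–Torregrosa CRM course
panama:302065049927689), pointed for the first time at period IDENTITIES rather than limit cycles.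
What it does that prior routes do not:
Grothendieck closes the lemniscatic sector by an ARITHMETIC count at the fixed CM fibre k² = 1/2
(trdeg 2, Chudnovsky1984) and excludes
non-CM moduli by name (trdeg 4 = barrier kzConjecture_implies_ellipticPeriods_algIndep); the zero
portrait decides the whole rational
Legendre-shape pencil transcendence-free (PencilPortrait: infinitely many non-CM moduli at once),
reduces the beta pencil to the hub's most
informative item 0312, and isolates all remaining arithmetic in ONE declared residue statement
(QuadraticResidue) about at most 4 pinned reals
per rational shape (QuadraticBudget). No oscillation-theoretic route exists on the summit (grep of
all 79 Theses files); negatives index untouched.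

RANKED CRUXES. #2 QuadraticBudget (crux) — BUDGET of the Legendre quadratic pencil, accuracy one
(card K3 made concrete; the rank ≥ 3 certificate the triage refuter asked for): every nontrivial
real combination a·K(√s)² + b·E(√s)K(√s) + c·E(√s)² + d has at most 4 zeros in s ∈ (0,1) (K(√s) =
∫_{(0,1)} dt/√((1−t²)(1−st²)), E(√s) = ∫_{(0,1)} √(1−st²)/√(1−t²) dt written inline in the parameter
m = s, Mathlib-only, since rev 1; dimension 4; planner float probe num/cheb_probe2.py: 4 zeros occur
for 92% of random 3-point interpolants, 5 never in 1.2·10⁵ trials; the 3-space {1,K²,EK} attains 3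
because the (K²,EK)-curve is convex at s→0, EK−π²/4 ~ (K²−π²/4)²/(2π²), and concave at s→1, EK ~ K).
[difficulty: L] (why it might fail: a 5th zero is a codimension-one accident nothing known forbids;
Petrov's argument-principle count for Sym²⊕1 on ℂ∖[1,∞) (jump K ↦ K ± 2iK′ across the cut makes the
imaginary part a quadratic form in K′ with its own zeros) may exceed 4.)
[doi:10.2140/pjm.2002.202.341, arXiv:math/0211386, arXiv:2405.16963, Lawden1989]
#3 PencilPortrait (crux) — for the Legendre shape (a,b,c) = (−1,2,0) and rational 0<s<1, value
equality of the pencil pair forces s = 1/2: D(s) = 2EK − K² − π/2 is strictly decreasing on (0,1)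
(D′ = E(E−K)/(s(1−s)) < 0 from Lawden (3.8.7), (3.8.12); tree lemmas LegendreRelation.hasDerivAt_Kt
/ hasDerivAt_Et) and vanishes at the lemniscatic fibre (tree theorem Lawden1989_eq_3_8_29_holds at k
= 1/√2); Fubini gives value = 2EK − K² and ∫_ℝ dx/(2(1+x²)) = π/2. Card worked theorem (F1 / P2) in
the calculus' own terms. [difficulty: M] (why it might fail: only as typed — Fubini/integrability
bookkeeping of the product integrand with (1−x²)^(−1/2) corner singularities on (0,1)² and the casts
s:ℚ→ℝ, √s; the analysis (monotonicity) is classical, AVV-type, and was re-derived numerically by the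
triage refuter.) [Lawden1989, KontsevichZagier2001, doi:10.2140/pjm.2002.202.341]
#4 GpcLegendreLemniscatic (crux) — Grothendieck's stmt-KontsevichZagierPeriods-0280 verbatim
(shared): the lemniscatic Legendre relation 2EK − K² = π/2 at k² = 1/2 as a KZ-equivalence of ONE
2-dimensional representation with [ℝ, 1/(2(1+x²))] — the single explained coincidence (ledger) of
the Legendre pencil. [difficulty: XL] (why it might fail: chain only in outline (McKean–Moll p. 62:
t = √2x/√(1+x²), one Newton–Leibniz move with x√(1−x²)/√(1+x²), u = x⁴ to Beta integrands,
Dirichlet's 2-dim change of variables); injectivity cells and absolute convergence at ≈ 12 moves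
unverified.) [MckeanMoll1999, WhittakerWatson1927, Lawden1989, Chudnovsky1984, KontsevichZagier2001]
#5 TriplicationAccessible (crux) — Neg's stmt-KontsevichZagierPeriods-0312 verbatim (shared with
FermatIsogeny / MultivaluedCoV): the Gauss-triplication pair B(1/9,4/9)·B(5/9,7/9) = 2π·3^(7/6)
(product of beta integrands on (0,1)² against the constant 3^(7/6)/2 on the disc of radius 2) is
KZ-accessible — the single explained coincidence of the beta pencil (s = 1/9). [difficulty: XL] (why
it might fail: it is route Neg's crux #2 negated: every printed proof leaves the calculus through Γ
or through Hodge classes on the degree-9 Fermat surface (Deligne1982HodgeCycles I 7.15); no chain is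
written.) [Deligne1982HodgeCycles, KoblitzRohrlich1978, KontsevichZagier2001]
#6 QuadraticResidue (crux) — RESIDUE of the Legendre pencil (declared GPC-strength; the card's K2):
for rational (a,b,c) ≠ (−1,2,0) and rational 0<s<1 the pencil pair never has equal values, i.e. aK²
+ bEK + cE² ≠ π/2 at k² = s. At s = 1/2 this is Chudnovsky + Legendre (the ℚ-relations of {K², EK,
E², π} form the line of Legendre's relation); at s ≠ 1/2 it says the ≤ 4 zeros per shape pinned by
QuadraticBudget are irrational — the counterexample to Conjecture 1 in this pencil, if any, IS one
of these reals; refuters run the zeros-first audit (locate, continued fractions), complete in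
height. [deps: QuadraticBudget] [difficulty: open-problem] (why it might fail: a rational
coincidence at a non-CM rational modulus would be a new quadratic period relation — GPC says no, but
nothing weaker than EllipticPeriodsAlgIndep proves it off s = 1/2; only André G-function proximity
(s = 1/b, b ≫ 1) is within reach today.) [Chudnovsky1984, Andre1989, arXiv:2405.16963,
KontsevichZagier2001]
#9 BetaPortrait (support) — the beta pencil s ↦ B(s,4/9)·B(5/9,7/9) is strictly decreasing in s > 0
(x^(s−1) decreases in s for x ∈ (0,1)) and equals the disc value 2π·3^(7/6) at s = 1/9 (Gauss
multiplication; Neg's TriplicationValueEq 1030), hence value equality forces s = 1/9. Card K1(a): a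
saturated pencil whose whole Conjecture-1 content is item 0312. [difficulty: provable-now]
[KontsevichZagier2001, Deligne1982HodgeCycles]
#9 LegendrePencilStrictAnti (support) — the card's worked theorem in analytic form (child of
PencilPortrait): s ↦ 2E(√s)K(√s) − K(√s)² (inline parameter-form integrals, rev 1) is strictly
decreasing on (0,1), from D′ = E(E−K)/(s(1−s)) and E < K. [difficulty: provable-now] [Lawden1989]
#9 PencilValue (support) — Fubini bookkeeping (child of PencilPortrait): a representation with the
pencil's domain (0,1)² and integrand a·k_s k_s + b·e_s k_s + c·e_s e_s has value aK(√s)² +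
bE(√s)K(√s) + cE(√s)², K(√s), E(√s) being the 1-D integrals over (0,1) of the same factors k_s, e_s
(inline, rev 1). [difficulty: provable-now] [Lawden1989, KontsevichZagier2001]
#9 PencilComplete (support) — NOT CLAIMED remainder (relative completeness, the shape of
GammaCornerAnomaly's MUMSectorComplete): for rational representations of equal value, [ρ] − [ρ′]
lies in KZ.relations ⊔ closure(equal-valued Legendre-pencil differences) ⊔ closure(equal-valued
beta-pencil differences). Implied by the summit, contentful on its own; nobody is expected to prove
it except by proving Conjecture 1 off the pencils; it is the splice point for further pencils.
[difficulty: open-problem] [KontsevichZagier2001, HuberMullerStach2017]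

TWO-LAYER PLAN. PencilPortrait ⇐ PencilValue → LegendrePencilStrictAnti → PencilPortrait (with tree
facts Lawden1989_eq_3_8_29_holds and Mathlib's
integral_univ_inv_one_add_sq); QuadraticResidue ⇐ ResidueAtHalf (s = 1/2: Chudnovsky + Lawden,
provable from the tree theorem
algebraicIndependent_real_pi_gamma_one_quarter) → ResidueOffHalf (s ≠ 1/2, GPC-strength) →
QuadraticResidue; QuadraticBudget ⇐ BudgetPetrov
(argument principle on ℂ∖[1,∞)) or BudgetRiccati (Rolle + Khovanskii for the Riccati equation t′ =
((1−s)(2t−1) − t²)/(2s(1−s)) of t = E/K: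
an explicit if unsharp N). Further pencils — Legendre-type shapes at class-number-one singular
moduli (√r·EK − (√r − α(r))K² = π/4), the
fourteen hypergeometric CY3 pencils at rank-2 attractor points (card K1(b)) — attach to
PencilComplete by glued splits.

KILL CRITERIA. QuadraticResidue refuted by a rational coincidence (s₀; a,b,c) is NOT a kill: it is a
new typed Conjecture-1 instance at a non-CM modulus —
add its chain as a crux and restate the residue around it. PencilPortrait / BetaPortrait refuted:
misstatement-class only (monotonicity is
certain) — restate. QuadraticBudget refuted (a 5th zero): the sharp count fails at rank 4; drop it
for BudgetRiccati (explicit Khovanskii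
N) — the glue does not use it. GpcLegendreLemniscatic or TriplicationAccessible refuted (possible
only through an additive invariant of
FormalRep separating equal values, Neg 0313): Neg's crux #2 is then a theorem and the summit is
FALSE — close `refuted:<Decl>` and escalate to
Neg. Mooted if Grothendieck's and FermatIsogeny's sectors close together with a kernel-form
completeness proved elsewhere.

NOT DECOMPOSED YET. The Petrov count itself (monodromy of (K², KE, E²) at s = 1, rotation of the
boundary curve); the Riccati/Khovanskii fallback constant;
effective LN-format N for general pencils (card K3; arXiv:2405.16963 gives towers); residue
irrationality inside the André proximity window
s = 1/b (route LiftingCriteria's tool); the algebraic-coefficient CM pencils and the attractor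
pencils (card K1(b),(c)); the zeros-first audit
as a refuter protocol (card (iii)). None is filed before PencilPortrait or QuadraticBudget closes.

CHEAPEST FALSIFIER. QuadraticBudget: a 340-digit mpmath re-run of the planner's float probe
(num/cheb_probe2.py: random 3-point interpolants in
span{1,K²,EK,E²}, sign changes on a log-refined grid of (0,1)) hunting a 5th sign change — one
certified example kills the crux (1.2·10⁵
float trials this session: max 4, histogram {1:3, 2:75, 3:4575, 4:55347}). QuadraticResidue: the
zeros-first audit on shapes (a,b,c) ∈
{−3..3}³ — locate each zero of aK²+bEK+cE²−π/2 to 300 digits, expand in continued fractions (card F6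
did (−q,2q,0): s = 0.328261715691632 for
q = 5/4, generic). PencilPortrait: done — 2EK − K² − π/2 = −2.5·10⁻¹⁴ at s = 1/2 (AGM, this
session), strictly decreasing on the grid
(triage refuter numcheck.py).

NUMBERS. K(1/√2) = 1.8540746773, E(1/√2) = 1.3506438810 (tree, Lawden (4.3.6)); 2EK − K² = π/2 =
1.5707963268 at s = 1/2; D(0⁺) = π²/4 − π/2 = 0.8966;
(s; K², EK, E²) = (0.5; 3.43759, 2.50419, 1.82424), (0.9; 6.64656, 2.84821, 1.22053), (0.999;
23.4366, 4.85164, 1.00435) (AGM float,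
num/cheb_probe.py); budget probe max sign changes: 4-space 4, 3-spaces {1,K²,EK} 3, {1,K²,E²} 2,
{1,EK,E²} 2, {K²,EK,E²} 2; beta pencil
B(1/9,4/9)·B(5/9,7/9) = 22.63712829483 = 2π·3^(7/6) (route Neg); card residues 2EK−K² = (5/4)π/2 at
s = 0.328261715691632, KE = (9/8)π²/4 at
s = 0.872325830388022 (triage refuter). Items at open: 10 (5 cruxes, 4 supports, 1 assembly).

DEFINITION REQUESTS. None. Since rev 1 (cone repair) the route file imports NO Literature module
beyond the Statement: K(√s) = ∫_{(0,1)} dt/√((1−t²)(1−st²)) and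
E(√s) = ∫_{(0,1)} √(1−st²)/√(1−t²) dt are written INLINE in the parameter m = s = k² (Mathlib's
Bochner integral over Set.Ioo 0 1); they ARE
`completeEllipticK/E (Real.sqrt s)` of
Literature.Analysis.SpecialFunctions.ZhouTripleEllipticIntegral by `unfold` + `Real.sq_sqrt`
(planner Bridge.lean:
old ↔ new statements, lean check rc 0), so provers import that module and its proof companions in
their Theorems files — LegendreRelation
(hasDerivAt_Kt/Et, completeEllipticK_eq_Kt/Et, Lawden1989_eq_3_8_29_holds), GlaisherThetaKIdentity
(hasDerivAt_completeEllipticK/E),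
ZhouTripleEllipticIntegralProofs (continuity, positivity, completeEllipticK_eq_ellipticK),
EllipticPeriodRatioDeriv — while the route's own cone
carries no named fact (the module's two facts Zhou2013_prop_5_1 / Lawden1989_eq_3_8_29 were never
hypotheses here and are both discharged in-tree:
Zhou2013_prop_5_1_holds, Lawden1989_eq_3_8_29_holds). KZ.IntegralRep / Equivalent / relations exist;
pencils are written as domain/integrand
hypotheses (hub idiom); the zero portrait itself is bookkeeping.

Novelty: Searches (2026-08-15): `lit search --source zbmath "Chebyshev property complete elliptic integrals"`
(8 rows: doi:10.2140/pjm.2002.202.341 GLLZ 2002 READ pp. 3–4, Thm 1 — fK + gE, f ∈ P_n, g ∈ P_m, has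
≤ n+m+2 zeros on (−1,1), accuracy one, by Petrov's argument principle; arXiv:math/0211386
Gavrilov–Iliev; LNM 1480); `lit galaxy search "Chebyshev property of elliptic integrals" --star all`
(2: Żołądek–Murillo, Christopher–Li–Torregrosa panama:302065049927689); `lit galaxy search "zeros of
complete elliptic integrals" --star all` (4: AGZV II panama:206295869161501, CLT, math/0205068,
math/0507061); `lit search --hybrid "Chebyshev system complete elliptic integrals … number of
zeros"` (12 vector rows, numerical-analysis noise); `lit frontier KontsevichZagierPeriods --since
2021` (30 rows: MZV / Nori / arXiv:2303.05030 GPC for CM Kummer surfaces; no oscillation theory);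
`lit bridges KontsevichZagierPeriods --cross any` (30 rows, none relevant); two `lit search --source
all` attempts rc 75; hub: grep of all 79 Theses files for Sturm|Chebyshev|disconjugacy|oscillation
(0 routes), Grothendieck / GammaCornerAnomaly / GaussManinCertificates / Neg read in full; the
card's own searches (arXiv:2405.16963 read pp. 1–4, CiE 2022 Skolem abstract, arXiv:1506.00318).
Nearest prior art found: doi:10.2140/pjm.2002.202.341 (GLLZ 2002: Chebyshev property with accuracy
one of {kⁱK, kʲE}, for limit cycles) with Petrov 1986/1988 (Chebyshev property of elliptic
integrals) — the engine, never aimed a  [refs: 10.2140/pjm.2002.202.341, math/0211386, 2303.05030, 2405.16963, 1506.00318, doi:10.2140/pjm.2002.202.341]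

Barriers (technique_class: real-oscillation-theory, sturm-disconjugacy, sector-transfer): - technique_class: real-oscillation-theory, sturm-disconjugacy, sector-transfer
- Literature.Barriers.KontsevichZagierPeriods.kzConjecture_implies_ellipticPeriods_algIndep: the
nearest barrier, and the line sits on both sides honestly — PencilPortrait decides infinitely many
non-CM rational moduli WITHOUT transcendence input (values differ by monotonicity: outside the
classes transcendence-methods / schneider-chudnovsky-elliptic-methods / masser-linear-relations the
block lists), while QuadraticResidue for the other shapes is conceded to have the barrier's strength
and is declared, not claimed; PencilComplete likewise.
- Literature.Barriers.KontsevichZagierPeriods.kzConjecture_implies_oddZetaAlgIndep: not engaged — no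
MZV sector is claimed; only PencilComplete has that strength and it is NOT CLAIMED.
- Literature.Barriers.KontsevichZagierPeriods.kzConjecture_implies_twoPiI_log_algIndep: not engaged
— no logarithmic sector is claimed.
- Literature.Barriers.KontsevichZagierPeriods.noSemialgebraicPrimitive_inv_sub_two: bites only on
the two chain cruxes (0280, 0312), exactly as recorded on routes Grothendieck and Neg; the portrait
items build no chain and integrate nothing out.
- Literature.Barriers.KontsevichZagierPeriods.not_complete_of_undecidable: consistent — nothing here
decides equality of two given periods; rationality of a residual zero is the undecided remainder and
the zeros-first audit is one-sided (it excludes, never confirms).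
- Literature.Barriers.KontsevichZagier

History (route lifecycle, newest last):
- 2026-08-15T18:56:15Z · rev 1: restated QuadraticBudget (stmt-KontsevichZagierPeriods-11725), LegendrePencilStrictAnti (stmt-KontsevichZagierPeriods-11729), PencilValue (stmt-KontsevichZagierPeriods-11730) — route-repair gen 1 (cone guardrail; planner-rrepair-KontsevichZagierPeriods-ZeroPo-e0102839-0). CONE AUDIT: payload.unproved_cone_facts  (planner-rrepair-KontsevichZagierPeriods-ZeroPo-e0102839-0)
- 2026-08-16T02:19:05Z · AUTO-CRUX: 1 conjecture-grade item(s) promoted to crux (PencilComplete) — refuter vetting / tiering apply (operator:999:1362873)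
- 2026-08-23T19:03:43Z · DORMANT — reconciler: no traction for 6.2 d (last activity item-evidence-added at 2026-08-17T14:22:03Z); parked, not closed — `ledger route dormant route-KontsevichZagier (operator:999:701113)

sub-problem: KontsevichZagierPeriods · status: dormant · opened planner-plancard-KontsevichZagierPeriods-Kont-cac3d51a-0 2026-08-15T18:38:24Z · rev 3 · ledger route-KontsevichZagierPeriods-ZeroPortrait
GENERATED by the gate from the ledger (D-0016/17). Provers cite these decls: `theorem foo : Summit.KontsevichZagierPeriods.KontsevichZagierPeriods.Theses.ZeroPortrait.<Decl> := …` in Summits/KontsevichZagierPeriods/KontsevichZagierPeriods/Theorems/<Name>.lean.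
-/

namespace Summit.KontsevichZagierPeriods.KontsevichZagierPeriods.Theses.ZeroPortrait

open scoped BigOperators Topology Manifold Classical MeasureTheory ProbabilityTheory Matrix InnerProductSpace ComplexConjugate ContinuousMap
open Filter Set Function TopologicalSpace MeasureTheory

attribute [summit_statement] _root_.KontsevichZagierPeriods

open Literature Periods

-- earlier QuadraticBudget (stmt-KontsevichZagierPeriods-11725, replaced 2026-08-15T18:56:15Z -> stmt-KontsevichZagierPeriods-12734): retired by None — ∀ (a b c d : ℝ), (a, b, c, d) ≠ (0, 0, 0, 0) → {s ∈ Set.Ioo (0:ℝ) 1 | a * Literature.Analysis.SpecialFunctions.completeEllipticK (Real.sqrt s) ^ 2 + b * Literature.Analysis.SpecialFunctions.completeEllipticE (Real.sqrt s) * Literature.Analysis.Special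
/-- item stmt-KontsevichZagierPeriods-12734 · crux · rank 2 · open · by planner
why it might fail: a 5th zero is a codimension-one accident nothing known forbids; Petrov's argument-principle count for Sym²⊕1 on ℂ∖[1,∞) (jump K ↦ K ± 2iK′ across the cut makes the imaginary part a quadratic form in K′ with its own zeros) may exceed 4.
sources: doi:10.2140/pjm.2002.202.341, arXiv:math/0211386, arXiv:2405.16963, Lawden1989
[crux] BUDGET of the Legendre quadratic pencil, accuracy one (card K3 made concrete; the rank ≥ 3
certificate the triage refuter asked for): every nontrivial real combination a·K² + b·EK + c·E² + d
— K = K(√s) = ∫_{(0,1)} dt/√((1−t²)(1−st²)), E = E(√s) = ∫_{(0,1)} √(1−st²)/√(1−t²) dt written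
INLINE in the parameter m = s = k² (Mathlib-only since rev 1, cone repair: = completeEllipticK/E
(Real.sqrt s) of Literature.Analysis.SpecialFunctions.ZhouTripleEllipticIntegral by unfold +
Real.sq_sqrt; old ↔ new certified in the planner's Bridge.lean, lean check rc 0) — has at most 4
zeros in s ∈ (0,1) (dimension 4; planner float probe num/cheb_probe2.py: 4 zeros occur for 92% of
random 3-point interpolants, 5 never in 1.2·10⁵ trials; the 3-space {1,K²,EK} attains 3 because the
(K²,EK)-curve is convex at s→0, EK−π²/4 ~ (K²−π²/4)²/(2π²), and concave at s→1, EK ~ K). Library for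
provers (import in the Theorems file, not in the route file): LegendreRelation (hasDerivAt_Kt/Et,
completeEllipticK_eq_Kt/Et, Lawden1989_eq_3_8_29_holds), GlaisherThetaKIdentity
(hasDerivAt_completeEllipticK/E), ZhouTripleEllipticIntegralProofs (continuity, positivity,
completeEllipticK_eq_ellipticK), EllipticPeriodRati -/
@[route_item "route-KontsevichZagierPeriods-ZeroPortrait"]
def QuadraticBudget : Prop :=
  ∀ (a b c d : ℝ), (a, b, c, d) ≠ (0, 0, 0, 0) → {s ∈ Set.Ioo (0:ℝ) 1 | a * (∫ t in Set.Ioo (0:ℝ) 1, 1 / Real.sqrt ((1 - t ^ 2) * (1 - s * t ^ 2))) ^ 2 + b * (∫ t in Set.Ioo (0:ℝ) 1, Real.sqrt (1 - s * t ^ 2) / Real.sqrt (1 - t ^ 2)) * (∫ t in Set.Ioo (0:ℝ) 1, 1 / Real.sqrt ((1 - t ^ 2) * (1 - s * t ^ 2))) + c * (∫ t in Set.Ioo (0:ℝ) 1, Real.sqrt (1 - s * t ^ 2) / Real.sqrt (1 - t ^ 2)) ^ 2 + d = 0}.encard ≤ 4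

/-- item stmt-KontsevichZagierPeriods-11726 · crux · rank 3 · open · by planner
why it might fail: only as typed — Fubini/integrability bookkeeping of the product integrand with (1−x²)^(−1/2) corner singularities on (0,1)² and the casts s:ℚ→ℝ, √s; the analysis (monotonicity) is classical, AVV-type, and was re-derived numerically by the triage refuter.
sources: Lawden1989, KontsevichZagier2001, doi:10.2140/pjm.2002.202.341
[crux] for the Legendre shape (a,b,c) = (−1,2,0) and rational 0<s<1, value equality of the pencil
pair forces s = 1/2: D(s) = 2EK − K² − π/2 is strictly decreasing on (0,1) (D′ = E(E−K)/(s(1−s)) < 0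
from Lawden (3.8.7), (3.8.12); tree lemmas LegendreRelation.hasDerivAt_Kt / hasDerivAt_Et) and
vanishes at the lemniscatic fibre (tree theorem Lawden1989_eq_3_8_29_holds at k = 1/√2); Fubini
gives value = 2EK − K² and ∫_ℝ dx/(2(1+x²)) = π/2. Card worked theorem (F1 / P2) in the calculus'
own terms. [difficulty: M] -/
@[route_item "route-KontsevichZagierPeriods-ZeroPortrait", crux]
def PencilPortrait : Prop :=
  ∀ (a b c s : ℚ), a = -1 → b = 2 → c = 0 → 0 < s → s < 1 → ∀ (r : Literature.NumberTheory.Transcendental.KZ.IntegralRep 2) (r' : Literature.NumberTheory.Transcendental.KZ.IntegralRep 1), r.domain = {x | ∀ i, x i ∈ Set.Ioo (0:ℝ) 1} → Set.EqOn r.integrand (fun x => (a : ℝ) * (1 / Real.sqrt ((1 - x 0 ^ 2) * (1 - (s : ℝ) * x 0 ^ 2)) * (1 / Real.sqrt ((1 - x 1 ^ 2) * (1 - (s : ℝ) * x 1 ^ 2)))) + (b : ℝ) * (Real.sqrt (1 - (s : ℝ) * x 0 ^ 2) / Real.sqrt (1 - x 0 ^ 2) * (1 / Real.sqrt ((1 -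 x 1 ^ 2) * (1 - (s : ℝ) * x 1 ^ 2)))) + (c : ℝ) * (Real.sqrt (1 - (s : ℝ) * x 0 ^ 2) / Real.sqrt (1 - x 0 ^ 2) * (Real.sqrt (1 - (s : ℝ) * x 1 ^ 2) / Real.sqrt (1 - x 1 ^ 2)))) r.domain → r'.domain = Set.univ → Set.EqOn r'.integrand (fun x => 1 / (2 * (1 + x 0 ^ 2))) r'.domain → r.value = r'.value → s = 1 / 2

/-- item stmt-KontsevichZagierPeriods-0280 · crux · rank 4 · closed · proved by Summit.KontsevichZagierPeriods.Grothendieck.GpcLegendreLemniscaticLine.GpcLegendreLemniscatic_proof @ 3de250ba37b9 (prover) · by planner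
why it might fail: chain only in outline (McKean–Moll p. 62: t = √2x/√(1+x²), one Newton–Leibniz move with x√(1−x²)/√(1+x²), u = x⁴ to Beta integrands, Dirichlet's 2-dim change of variables); injectivity cells and absolute convergence at ≈ 12 moves unverified.
sources: MckeanMoll1999, WhittakerWatson1927, Lawden1989, Chudnovsky1984, KontsevichZagier2001
K = ∫₀¹ dx/√((1−x²)(1−x²/2)), E = ∫₀¹ √(1−x²/2)/√(1−x²) dx (complete elliptic integrals, modulus k²
= 1/2, lemniscatic/CM curve, K′ = K, E′ = E); Legendre: EK′ + E′K − KK′ = π/2 becomes 2EK − K² = π/2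
(checked numerically to 1e−13). LHS filed as ONE 2-dim semialgebraic rep on (0,1)² with integrand
2e(x)k(y) − k(x)k(y); RHS as ∫_ℝ dx/(2(1+x²)). Motivic origin: the cup-product/Poincaré-duality
pairing H¹_dR × H¹_dR → H²_dR(E) ≅ ℚ̄(−1) of the elliptic curve y² = (1−x²)(1−x²/2) — a 'boundary +
functoriality' relation in the formal period algebra, hence predicted to lie in KZ.relations by
route NoriTransfer #2. Known proofs differentiate in k (a RELATIVE-period argument à la Ayoub) or
integrate over the period parallelogram (transcendental uniformisation); an H21 proof must run
Stokes on a semialgebraic 2-chain in E(ℂ) ⊂ ℝ⁴ cut along real-algebraic paths, reduced to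
Newton–Leibniz bands. Chudnovsky1976 (tree fact) shows trdeg ℚ(K, E, π) = 2, so this is the ONLY
algebraic relation among K, E, π up to the ideal it generates — a complete sector once accessible.
[elaborates: yes: _survey/SketchC.lean; sources: Chudnovsky1976, KontsevichZagier2001,
HuberMullerStach2017, Andre2004] -/
@[route_item "route-KontsevichZagierPeriods-ZeroPortrait", crux]
def GpcLegendreLemniscatic : Prop :=
  ∀ (r : Literature.NumberTheory.Transcendental.KZ.IntegralRep 2) (r' : Literature.NumberTheory.Transcendental.KZ.IntegralRep 1), r.domain = {x | ∀ i, x i ∈ Set.Ioo (0:ℝ) 1} → Set.EqOn r.integrand (fun x => 2 * Real.sqrt (1 - x 0 ^ 2 / 2) / Real.sqrt (1 - x 0 ^ 2) / Real.sqrt ((1 - x 1 ^ 2) * (1 - x 1 ^ 2 / 2)) - 1 / Real.sqrt ((1 - x 0 ^ 2) * (1 - x 0 ^ 2 / 2)) / Real.sqrt ((1 - x 1 ^ 2) * (1 - x 1 ^ 2 / 2))) r.domain → r'.domain = Set.univ → Set.EqOn r'.integrand (fun x => 1 / (2 * (1 + x 0 ^ 2))) r'.domain → Literature.NumberTheory.Transcendental.KZ.Equivalent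 r r'

/-- `GpcLegendreLemniscatic` holds: proved by `Summit.KontsevichZagierPeriods.Grothendieck.GpcLegendreLemniscaticLine.GpcLegendreLemniscatic_proof` @ 3de250ba37b9. -/
theorem GpcLegendreLemniscatic_holds : GpcLegendreLemniscatic := _root_.Summit.KontsevichZagierPeriods.Grothendieck.GpcLegendreLemniscaticLine.GpcLegendreLemniscatic_proof

/-- item stmt-KontsevichZagierPeriods-0312 · crux · rank 5 · open · by planner
why it might fail: it is route Neg's crux #2 negated: every printed proof leaves the calculus through Γ or through Hodge classes on the degree-9 Fermat surface (Deligne1982HodgeCycles I 7.15); no chain is written.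
sources: Deligne1982HodgeCycles, KoblitzRohrlich1978, KontsevichZagier2001
Positive form of #2. A proof must avoid Γ: candidate strategy = realise the degree-9 Fermat-curve
correspondence behind the identity as semialgebraic changes of variables between (blow-ups of)
(0,1)² pieces plus Newton–Leibniz with algebraic primitives (Rohrlich/Deligne distribution relations
are induced by the maps x ↦ x³ on Fermat curves — algebraic, finite ⇒ CoV on injectivity cells). If
found, pressure point (b) of route Neg dies at its first instance. [elaborates: yes:
_survey/SketchB.lean; sources: Deligne1982HodgeCycles, KontsevichZagier2001] -/
@[route_item "route-KontsevichZagierPeriods-ZeroPortrait", crux]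
def TriplicationAccessible : Prop :=
  ∀ (r r' : Literature.NumberTheory.Transcendental.KZ.IntegralRep 2), r.domain = {x | ∀ i, x i ∈ Set.Ioo (0:ℝ) 1} → Set.EqOn r.integrand (fun x => (x 0) ^ (-(8:ℝ)/9) * (1 - x 0) ^ (-(5:ℝ)/9) * (x 1) ^ (-(4:ℝ)/9) * (1 - x 1) ^ (-(2:ℝ)/9)) r.domain → r'.domain = {x | x 0 ^ 2 + x 1 ^ 2 < 4} → Set.EqOn r'.integrand (fun _ => (3:ℝ) ^ ((7:ℝ)/6) / 2) r'.domain → Literature.NumberTheory.Transcendental.KZ.Equivalent r r'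

/-- item stmt-KontsevichZagierPeriods-11727 · crux · rank 6 · open · by planner
why it might fail: a rational coincidence at a non-CM rational modulus would be a new quadratic period relation — GPC says no, but nothing weaker than EllipticPeriodsAlgIndep proves it off s = 1/2; only André G-function proximity (s = 1/b, b ≫ 1) is within reach today.
sources: Chudnovsky1984, Andre1989, arXiv:2405.16963, KontsevichZagier2001
[crux] RESIDUE of the Legendre pencil (declared GPC-strength; the card's K2): for rational (a,b,c) ≠
(−1,2,0) and rational 0<s<1 the pencil pair never has equal values, i.e. aK² + bEK + cE² ≠ π/2 at k²
= s. At s = 1/2 this is Chudnovsky + Legendre (the ℚ-relations of {K², EK, E², π} form the line of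
Legendre's relation); at s ≠ 1/2 it says the ≤ 4 zeros per shape pinned by QuadraticBudget are
irrational — the counterexample to Conjecture 1 in this pencil, if any, IS one of these reals;
refuters run the zeros-first audit (locate, continued fractions), complete in height. [deps:
QuadraticBudget] [difficulty: open-problem] -/
@[route_item "route-KontsevichZagierPeriods-ZeroPortrait", crux]
def QuadraticResidue : Prop :=
  ∀ (a b c s : ℚ), ((a, b, c) : ℚ × ℚ × ℚ) ≠ (-1, 2, 0) → 0 < s → s < 1 → ∀ (r : Literature.NumberTheory.Transcendental.KZ.IntegralRep 2) (r' : Literature.NumberTheory.Transcendental.KZ.IntegralRep 1), r.domain = {x | ∀ i, x i ∈ Set.Ioo (0:ℝ) 1} → Set.EqOn r.integrand (fun x => (a : ℝ) * (1 / Real.sqrt ((1 - x 0 ^ 2) * (1 - (s : ℝ) * x 0 ^ 2)) * (1 / Real.sqrt ((1 - x 1 ^ 2) * (1 - (s : ℝ) * x 1 ^ 2)))) + (b : ℝ) * (Real.sqrt (1 - (s : ℝ) * x 0 ^ 2) / Real.sqrt (1 - x 0 ^ 2) * (1 / Real.sqrt ((1 - x 1 ^ 2) * (1 - (s : ℝ)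 * x 1 ^ 2)))) + (c : ℝ) * (Real.sqrt (1 - (s : ℝ) * x 0 ^ 2) / Real.sqrt (1 - x 0 ^ 2) * (Real.sqrt (1 - (s : ℝ) * x 1 ^ 2) / Real.sqrt (1 - x 1 ^ 2)))) r.domain → r'.domain = Set.univ → Set.EqOn r'.integrand (fun x => 1 / (2 * (1 + x 0 ^ 2))) r'.domain → r.value ≠ r'.value

/-- item stmt-KontsevichZagierPeriods-11731 · crux (kind.auto-crux: conjecture-grade) · rank 9 · open · by planner
why it might fail: auto-crux — conjecture-grade statement (docstring avows it ('Conjecture')); it is open, so it may simply be false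
sources: KontsevichZagier2001, HuberMullerStach2017
[support] NOT CLAIMED remainder (relative completeness, the shape of GammaCornerAnomaly's
MUMSectorComplete): for rational representations of equal value, [ρ] − [ρ′] lies in KZ.relations ⊔
closure(equal-valued Legendre-pencil differences) ⊔ closure(equal-valued beta-pencil differences).
Implied by the summit, contentful on its own; nobody is expected to prove it except by proving
Conjecture 1 off the pencils; it is the splice point for further pencils. [difficulty: open-problem] -/
@[route_item "route-KontsevichZagierPeriods-ZeroPortrait", crux]
def PencilComplete : Prop :=
  ∀ ⦃n m : ℕ⦄ (ρ : Literature.NumberTheory.Transcendental.KZ.IntegralRep n) (ρ' : Literature.NumberTheory.Transcendental.KZ.IntegralRep m), ρ.IsRational → ρ'.IsRational → ρ.value = ρ'.value → Literature.NumberTheory.Transcendental.KZ.of ρ - Literature.NumberTheory.Transcendental.KZ.of ρ' ∈ Literature.NumberTheory.Transcendental.KZ.relations ⊔ AddSubgroup.closure {d | ∃ (a b c s : ℚ) (r : Literature.NumberTheory.Transcendental.KZ.IntegralRep 2) (r' : Literature.NumberTheory.Transcendental.KZ.IntegralRep 1), 0 < s ∧ s < 1 ∧ r.domain = {x | ∀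 i, x i ∈ Set.Ioo (0:ℝ) 1} ∧ Set.EqOn r.integrand (fun x => (a : ℝ) * (1 / Real.sqrt ((1 - x 0 ^ 2) * (1 - (s : ℝ) * x 0 ^ 2)) * (1 / Real.sqrt ((1 - x 1 ^ 2) * (1 - (s : ℝ) * x 1 ^ 2)))) + (b : ℝ) * (Real.sqrt (1 - (s : ℝ) * x 0 ^ 2) / Real.sqrt (1 - x 0 ^ 2) * (1 / Real.sqrt ((1 - x 1 ^ 2) * (1 - (s : ℝ) * x 1 ^ 2)))) + (c : ℝ) * (Real.sqrt (1 - (s : ℝ) * x 0 ^ 2) / Real.sqrt (1 - x 0 ^ 2) * (Real.sqrt (1 - (s : ℝ) * x 1 ^ 2) / Real.sqrt (1 - x 1 ^ 2)))) r.domain ∧ r'.domain = Set.univ ∧ Set.EqOn r'.integrand (fun x => 1 / (2 * (1 + x 0 ^ 2))) r'.domain ∧ r.value = r'.value ∧ d = Literature.NumberTheory.Transcendental.KZ.of r - Literature.NumberTheory.Transcendental.KZ.of r'} ⊔ AddSubgroup.closure {d | ∃ (s : ℚ) (r r' : Literature.NumberTheory.Transcendental.KZ.IntegralRep 2), 0 <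 s ∧ r.domain = {x | ∀ i, x i ∈ Set.Ioo (0:ℝ) 1} ∧ Set.EqOn r.integrand (fun x => (x 0) ^ ((s : ℝ) - 1) * (1 - x 0) ^ (-(5:ℝ)/9) * (x 1) ^ (-(4:ℝ)/9) * (1 - x 1) ^ (-(2:ℝ)/9)) r.domain ∧ r'.domain = {x | x 0 ^ 2 + x 1 ^ 2 < 4} ∧ Set.EqOn r'.integrand (fun _ => (3:ℝ) ^ ((7:ℝ)/6) / 2) r'.domain ∧ r.value = r'.value ∧ d = Literature.NumberTheory.Transcendental.KZ.of r - Literature.NumberTheory.Transcendental.KZ.of r'}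

/-- item stmt-KontsevichZagierPeriods-11728 · support · rank 9 · closed · proved by Summit.KontsevichZagierPeriods.ZeroPortrait.betaPortrait_proof @ 04834ce9ffa2 (prover) · by planner
sources: KontsevichZagier2001, Deligne1982HodgeCycles
[support] the beta pencil s ↦ B(s,4/9)·B(5/9,7/9) is strictly decreasing in s > 0 (x^(s−1) decreases
in s for x ∈ (0,1)) and equals the disc value 2π·3^(7/6) at s = 1/9 (Gauss multiplication; Neg's
TriplicationValueEq 1030), hence value equality forces s = 1/9. Card K1(a): a saturated pencil whose
whole Conjecture-1 content is item 0312. [difficulty: provable-now] -/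
@[route_item "route-KontsevichZagierPeriods-ZeroPortrait", crux]
def BetaPortrait : Prop :=
  ∀ (s : ℚ), 0 < s → ∀ (r r' : Literature.NumberTheory.Transcendental.KZ.IntegralRep 2), r.domain = {x | ∀ i, x i ∈ Set.Ioo (0:ℝ) 1} → Set.EqOn r.integrand (fun x => (x 0) ^ ((s : ℝ) - 1) * (1 - x 0) ^ (-(5:ℝ)/9) * (x 1) ^ (-(4:ℝ)/9) * (1 - x 1) ^ (-(2:ℝ)/9)) r.domain → r'.domain = {x | x 0 ^ 2 + x 1 ^ 2 < 4} → Set.EqOn r'.integrand (fun _ => (3:ℝ) ^ ((7:ℝ)/6) / 2) r'.domain → r.value = r'.value → s = 1 / 9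

-- earlier LegendrePencilStrictAnti (stmt-KontsevichZagierPeriods-11729, replaced 2026-08-15T18:56:15Z -> stmt-KontsevichZagierPeriods-12735): retired by None — StrictAntiOn (fun s : ℝ => 2 * Literature.Analysis.SpecialFunctions.completeEllipticE (Real.sqrt s) * Literature.Analysis.SpecialFunctions.completeEllipticK (Real.sqrt s) - Literature.Analysis.SpecialFunctions.completeEllipticK (Real.sqrt s) 
/-- item stmt-KontsevichZagierPeriods-12735 · support · rank 9 · open · by planner
sources: Lawden1989
[support] the card's worked theorem in analytic form (child of PencilPortrait): s ↦ 2EK − K², with K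
= ∫_{(0,1)} dt/√((1−t²)(1−st²)) (= completeEllipticK (√s)) and E = ∫_{(0,1)} √(1−st²)/√(1−t²) dt (=
completeEllipticE (√s)) written INLINE in the parameter m = s (Mathlib-only since rev 1; bridge:
unfold + Real.sq_sqrt, planner Bridge.lean strictAnti_iff), is strictly decreasing on (0,1): in m =
s one has dK/ds = (E − (1−s)K)/(2s(1−s)), dE/ds = (E − K)/(2s) (Lawden (3.8.7), (3.8.12); tree:
LegendreRelation.hasDerivAt_Kt / hasDerivAt_Et), hence D′ = d/ds(2EK − K²) = E(E−K)/(s(1−s)) < 0 by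
E < K. [difficulty: provable-now] -/
@[route_item "route-KontsevichZagierPeriods-ZeroPortrait"]
def LegendrePencilStrictAnti : Prop :=
  StrictAntiOn (fun s : ℝ => 2 * (∫ t in Set.Ioo (0:ℝ) 1, Real.sqrt (1 - s * t ^ 2) / Real.sqrt (1 - t ^ 2)) * (∫ t in Set.Ioo (0:ℝ) 1, 1 / Real.sqrt ((1 - t ^ 2) * (1 - s * t ^ 2))) - (∫ t in Set.Ioo (0:ℝ) 1, 1 / Real.sqrt ((1 - t ^ 2) * (1 - s * t ^ 2))) ^ 2) (Set.Ioo (0:ℝ) 1)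

-- earlier PencilValue (stmt-KontsevichZagierPeriods-11730, replaced 2026-08-15T18:56:15Z -> stmt-KontsevichZagierPeriods-12736): retired by None — ∀ (a b c s : ℚ), 0 < s → s < 1 → ∀ (r : Literature.NumberTheory.Transcendental.KZ.IntegralRep 2), r.domain = {x | ∀ i, x i ∈ Set.Ioo (0:ℝ) 1} → Set.EqOn r.integrand (fun x => (a : ℝ) * (1 / Real.sqrt ((1 - x 0 ^ 2) * (1 - (s : ℝ) * x 0 ^ 2)) * (1 / Real.s
/-- item stmt-KontsevichZagierPeriods-12736 · support · rank 9 · closed · proved by Summit.KontsevichZagierPeriods.ZeroPortrait.pencilValue_proof @ 7d4dd064ec38 (prover) · by planner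
sources: Lawden1989, KontsevichZagier2001
[support] Fubini bookkeeping (child of PencilPortrait): a representation with the pencil's domain
(0,1)² and integrand a·k_s(x₀)k_s(x₁) + b·e_s(x₀)k_s(x₁) + c·e_s(x₀)e_s(x₁) has value a·K² + b·E·K +
c·E², where K = ∫_{(0,1)} k_s and E = ∫_{(0,1)} e_s are the 1-D Bochner integrals of the SAME
factors k_s(t) = 1/√((1−t²)(1−st²)), e_s(t) = √(1−st²)/√(1−t²) (inline, Mathlib-only since rev 1; =
completeEllipticK/E (√s) by unfold + Real.sq_sqrt): MeasurableEquiv.finTwoArrow /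
volume_preserving_finTwoArrow to (0,1)×(0,1), MeasureTheory.setIntegral_prod_mul, integrability of
k_s, e_s on (0,1) (K side in ZhouTripleEllipticIntegralProofs). [difficulty: provable-now] -/
@[route_item "route-KontsevichZagierPeriods-ZeroPortrait"]
def PencilValue : Prop :=
  ∀ (a b c s : ℚ), 0 < s → s < 1 → ∀ (r : Literature.NumberTheory.Transcendental.KZ.IntegralRep 2), r.domain = {x | ∀ i, x i ∈ Set.Ioo (0:ℝ) 1} → Set.EqOn r.integrand (fun x => (a : ℝ) * (1 / Real.sqrt ((1 - x 0 ^ 2) * (1 - (s : ℝ) * x 0 ^ 2)) * (1 / Real.sqrt ((1 - x 1 ^ 2) * (1 - (s : ℝ) * x 1 ^ 2)))) + (b : ℝ) * (Real.sqrt (1 - (s : ℝ) * x 0 ^ 2) / Real.sqrt (1 - x 0 ^ 2) * (1 / Real.sqrt ((1 - x 1 ^ 2) * (1 - (s : ℝ) * x 1 ^ 2)))) + (c : ℝ) * (Real.sqrt (1 - (s : ℝ) * x 0 ^ 2) / Real.sqrt (1 - x 0 ^ 2) * (Real.sqrt (1 - (s : ℝ) * x 1 ^ 2) / Real.sqrt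 (1 - x 1 ^ 2)))) r.domain → r.value = (a : ℝ) * (∫ t in Set.Ioo (0:ℝ) 1, 1 / Real.sqrt ((1 - t ^ 2) * (1 - (s : ℝ) * t ^ 2))) ^ 2 + (b : ℝ) * (∫ t in Set.Ioo (0:ℝ) 1, Real.sqrt (1 - (s : ℝ) * t ^ 2) / Real.sqrt (1 - t ^ 2)) * (∫ t in Set.Ioo (0:ℝ) 1, 1 / Real.sqrt ((1 - t ^ 2) * (1 - (s : ℝ) * t ^ 2))) + (c : ℝ) * (∫ t in Set.Ioo (0:ℝ) 1, Real.sqrt (1 - (s : ℝ) * t ^ 2) / Real.sqrt (1 - t ^ 2)) ^ 2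

/-- item stmt-KontsevichZagierPeriods-11732 · assembly · rank 1 · closed · proved by Summit.KontsevichZagierPeriods.ZeroPortrait.assembly_proof @ f427cf72cf92 (prover) · by planner
sources: KontsevichZagier2001
[assembly] PencilPortrait → QuadraticResidue → GpcLegendreLemniscatic → BetaPortrait →
TriplicationAccessible → PencilComplete → the Statement. -/
@[route_item "route-KontsevichZagierPeriods-ZeroPortrait"]
def Assembly : Prop :=
  PencilPortrait → QuadraticResidue → GpcLegendreLemniscatic → BetaPortrait → TriplicationAccessible → PencilComplete → KontsevichZagierPeriods

/-! D-0027 §2.1 — DECIDING THEOREM (planner-authored via `route open/edit --closes-file`; by planner-plancard-KontsevichZagierPeriods-Kont-cac3d51a-0 2026-08-15T18:38:25Z):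
its hypotheses are this route's items and its conclusion the sub-problem Statement (glue_lint), and it elaborates with this file. -/

@[closes "route-KontsevichZagierPeriods-ZeroPortrait"] theorem closes (hP : PencilPortrait) (hR : QuadraticResidue) (hL : GpcLegendreLemniscatic)
    (hB : BetaPortrait) (hT : TriplicationAccessible) (hC : PencilComplete) :
    KontsevichZagierPeriods := by
  intro n m ρ ρ' hρ hρ' hv
  have hmem := hC ρ ρ' hρ hρ' hv
  refine (sup_le (sup_le le_rfl ((AddSubgroup.closure_le _).mpr ?_)) ((AddSubgroup.closure_le _).mpr ?_)) hmem
  · rintro d ⟨a, b, c, s, r, r', hs0, hs1, hdom, hint, hdom', hint', hval, rfl⟩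
    by_cases habc : ((a, b, c) : ℚ × ℚ × ℚ) = (-1, 2, 0)
    · simp only [Prod.mk.injEq] at habc
      obtain ⟨ha, hb, hc⟩ := habc
      have hs : s = 1 / 2 := hP a b c s ha hb hc hs0 hs1 r r' hdom hint hdom' hint' hval
      subst ha hb hc hs
      refine hL r r' hdom ?_ hdom' hint'
      intro x hx
      rw [hint hx]
      push_cast
      ring_nf
    · exact absurd hval (hR a b c s habc hs0 hs1 r r' hdom hint hdom' hint')
  · rintro d ⟨s, r, r', hs0, hdom, hint, hdom', hint', hval, rfl⟩
    have hs : s = 1 / 9 := hB s hs0 r r' hdom hint hdom' hint' hval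
    subst hs
    refine hT r r' hdom ?_ hdom' hint'
    intro x hx
    rw [hint hx]
    push_cast
    norm_num

end Summit.KontsevichZagierPeriods.KontsevichZagierPeriods.Theses.ZeroPortrait
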